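import Literature.Computability.Complexity.UmansFPPolys
import Literature.InformationTheory.Coding.SudanRRLoop
import HarnessLib

/-!
# Umans' generator, machine level V: Roth–Ruckenstein root finding on bitmask coefficient lists

Literature / circuit complexity — derandomization. Fifth machine-level file of the tree's proof of
C. Umans, JCSS 2003, Thm. 6. Bivariate polynomials `Q ∈ K[X][Y]` over `K = GF2 M` travel as lists
of `X`-coefficient lists (`Y`-major), read by `UmansFP.bivOf M`. This file writes the breadth-first
loop form `SudanRR.rrLevels` (`InformationTheory/Coding/SudanRRLoop.lean`) of Roth–Ruckenstein's
recursion as a program on such lists and proves that, on REDUCED data, it is carried to `rrLevels`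
by the interpretation `castNode = (map elt, bivOf)`:

* `bivOf`, `coeff_bivOf`, `bivOf_cons`, `bivOf_eq_zero_iff`;
* the primitives and what they compute: `atZeroL` (`Q(0, Y)`), `bIsZero`, `xvalL`/`stripXL`
  (`xvalL_eq_xval`, `bivOf_stripXL`: the `X`-content and its removal), `mulS`/`addHead`/`shiftYL`
  (`bivOf_shiftYL : bivOf (shiftYL …) = shiftY (bivOf …) (elt γ)`, Horner in `Y`), `childQL`,
  `rootsLK` (`map_rootsLK`), `rrExpandL` (`map_rrExpandL`), **`rrLevelsL`** (`map_rrLevelsL`);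
* **`rrLevelsL_complete`**: for reduced `Ql` with `bivOf Ql ≠ 0` of `Y`-degree `< cap`, every
  `Y`-root `f` of degree `≤ D` is `polyOfList p` for some listed path `p` of level `D + 1`, and all
  listed paths are reduced of length `D + 1`.

Everything is proved; no named fact. The `CodeFP` certificate is in the next file.

## References

* R. M. Roth, G. Ruckenstein, IEEE Trans. Inform. Theory 46 (2000), §V–VI [RothRuckenstein2000].
* C. Umans, *Pseudo-random generators for all hardnesses*, JCSS 67 (2003), §6.2 [Umans2003].
* D. E. Knuth, *The Art of Computer Programming*, Vol. 2, §4.6.1, §4.6.4 [KnuthTAOCP2].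
-/

noncomputable section

namespace Literature.Computability.Complexity

open Polynomial Literature.InformationTheory.Coding Literature.InformationTheory.Coding.SudanRR
open Literature.InformationTheory.Coding.GF2X CodeFP
open scoped Polynomial.Bivariate

namespace UmansFP

variable (M : ℕ)

/-! ### Bivariate polynomials as lists of coefficient lists -/

/-- **The bivariate polynomial of a list of coefficient lists** (`Y`-major):
`[Q₀, Q₁, …] ↦ Σ_j Q_j(X) Yʲ`. [cite: Umans2003, §6.2] -/
def bivOf (Ql : List (List ℕ)) : (GF2 M)[X][Y] :=
  ∑ j ∈ Finset.range Ql.length, C (polyOfList M (Ql.getD j [])) * Y ^ j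

/-- Coefficients of `bivOf`. [folklore] -/
theorem coeff_bivOf (Ql : List (List ℕ)) (j : ℕ) :
    (bivOf M Ql).coeff j = if j < Ql.length then polyOfList M (Ql.getD j []) else 0 := by
  rw [bivOf, finsetSum_coeff]
  simp_rw [coeff_C_mul_X_pow]
  rw [Finset.sum_ite_eq (Finset.range Ql.length) j]
  simp [Finset.mem_range]

/-- `bivOf (P :: rest) = P + Y · bivOf rest`. [folklore] -/
theorem bivOf_cons (P : List ℕ) (Ql : List (List ℕ)) : bivOf M (P :: Ql) = C (polyOfList M P) + Y * bivOf M Ql := by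
  ext j : 1
  rw [coeff_add, coeff_C, coeff_bivOf]
  cases j with
  | zero => rw [mul_comm, coeff_mul_X_zero, if_pos (by simp), if_pos rfl, add_zero, List.getD_cons_zero]
  | succ j =>
    rw [mul_comm, coeff_mul_X, coeff_bivOf, List.length_cons, List.getD_cons_succ, if_neg (Nat.succ_ne_zero j), zero_add]
    by_cases h : j < Ql.length
    · rw [if_pos (by omega), if_pos h]
    · rw [if_neg (by omega), if_neg h]

/-- `bivOf [] = 0`. [folklore] -/
@[simp] theorem bivOf_nil : bivOf M [] = 0 := by simp [bivOf]

variable {M}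

/-- **A reduced matrix reads as `0` iff every row reads as `0`.** [folklore] -/
theorem bivOf_eq_zero_iff {Ql : List (List ℕ)} : bivOf M Ql = 0 ↔ ∀ r ∈ Ql, polyOfList M r = 0 := by
  constructor
  · intro h r hr
    obtain ⟨j, hj, rfl⟩ := List.getElem_of_mem hr
    have hc := congrArg (fun q : (GF2 M)[X][Y] => q.coeff j) h
    simp only [coeff_bivOf, if_pos hj, coeff_zero] at hc
    rwa [List.getD_eq_getElem _ _ hj] at hc
  · intro h
    ext j : 1
    rw [coeff_bivOf, coeff_zero]
    split_ifs with hj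
    · rw [List.getD_eq_getElem _ _ hj]; exact h _ (List.getElem_mem hj)
    · rfl

/-- `KRedRows` on `cons`. [folklore] -/
theorem KRedRows.cons {P : List ℕ} {Ql : List (List ℕ)} (hP : KRed M P) (h : KRedRows M Ql) : KRedRows M (P :: Ql) := by
  intro r hr
  rcases List.mem_cons.1 hr with rfl | hr
  · exact hP
  · exact h r hr

/-- Rows of reduced matrices, by index. [folklore] -/
theorem KRedRows.getD {Ql : List (List ℕ)} (h : KRedRows M Ql) (j : ℕ) : KRed M (Ql.getD j []) := by
  by_cases hj : j < Ql.length
  · rw [List.getD_eq_getElem _ _ hj]; exact h _ (List.getElem_mem hj)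
  · rw [List.getD_eq_default _ _ (not_lt.1 hj)]; exact KRed.nil

/-! ### `Q(0, Y)`, the zero test, the `X`-content -/

/-- **`Q(0, Y)`** on lists: the constant coefficients. [cite: RothRuckenstein2000, §V, Lemma 5.1] -/
def atZeroL (Ql : List (List ℕ)) : List ℕ := Ql.map fun r => r.headD 0

/-- The constant coefficient of `polyOfList r` is `elt (r.headD 0)`. [folklore] -/
theorem coeff_zero_polyOfList (M : ℕ) (r : List ℕ) : (polyOfList M r).coeff 0 = GF2.elt M (r.headD 0) := by
  cases r with
  | nil => rw [polyOfList_nil, coeff_zero, List.headD_nil, GF2.elt, bitsPoly_zero, map_zero]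
  | cons a r => rw [polyOfList_cons, coeff_add, coeff_C_zero, mul_comm, coeff_mul_X_zero, add_zero, List.headD_cons]

variable (M)

/-- **`atZeroL` computes `Q(0, Y)`** (no reducedness needed), and is reduced on reduced data. [folklore] -/
theorem polyOfList_atZeroL (Ql : List (List ℕ)) : polyOfList M (atZeroL Ql) = atZero (bivOf M Ql) := by
  ext j
  rw [coeff_atZero, coeff_bivOf, coeff_polyOfList, atZeroL, List.length_map]
  split_ifs with hj
  · rw [List.getD_eq_getElem _ _ (by rw [List.length_map]; exact hj), List.getElem_map, coeff_zero_polyOfList,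
      List.getD_eq_getElem _ _ hj]
  · rw [coeff_zero]

variable {M}

/-- `atZeroL` of reduced rows is reduced. [folklore] -/
theorem KRedRows.atZeroL {Ql : List (List ℕ)} (h : KRedRows M Ql) : KRed M (atZeroL Ql) := by
  intro x hx
  obtain ⟨r, hr, rfl⟩ := List.mem_map.1 hx
  exact (h r hr).headD

/-- **Zero test** on lists. [folklore] -/
def bIsZero (Ql : List (List ℕ)) : Bool := Ql.all kpIsZero

/-- The zero test is correct on reduced data. [folklore] -/
theorem bIsZero_iff {Ql : List (List ℕ)} (h : KRedRows M Ql) : bIsZero Ql = true ↔ bivOf M Ql = 0 := by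
  rw [bivOf_eq_zero_iff, bIsZero, List.all_eq_true]
  exact ⟨fun H r hr => (kpIsZero_iff (h r hr)).1 (H r hr), fun H r hr => (kpIsZero_iff (h r hr)).2 (H r hr)⟩

/-- The widest row (a default exceeding every valuation). [folklore] -/
def bMaxLen (Ql : List (List ℕ)) : ℕ := (Ql.map List.length).foldl max 0

/-- `foldl max` dominates its items and its start. [folklore] -/
theorem le_foldl_max : ∀ (l : List ℕ) (b : ℕ), b ≤ l.foldl max b ∧ ∀ x ∈ l, x ≤ l.foldl max b
  | [], b => ⟨le_rfl, fun x hx => by simp at hx⟩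
  | a :: l, b => by
    obtain ⟨h1, h2⟩ := le_foldl_max l (max b a)
    refine ⟨(le_max_left _ _).trans h1, fun x hx => ?_⟩
    rcases List.mem_cons.1 hx with rfl | hx
    · exact (le_max_right _ _).trans h1
    · exact h2 x hx

/-- Every row is at most as wide as `bMaxLen`. [folklore] -/
theorem length_le_bMaxLen {Ql : List (List ℕ)} {r : List ℕ} (hr : r ∈ Ql) : r.length ≤ bMaxLen Ql :=
  (le_foldl_max _ 0).2 _ (List.mem_map.2 ⟨r, hr, rfl⟩)

/-- `foldl min` is below its start and its items, and is one of them. [folklore] -/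
theorem foldl_min_spec : ∀ (l : List ℕ) (b : ℕ), l.foldl min b ≤ b ∧ (∀ x ∈ l, l.foldl min b ≤ x) ∧
    (l.foldl min b = b ∨ l.foldl min b ∈ l)
  | [], b => ⟨le_rfl, fun x hx => by simp at hx, Or.inl rfl⟩
  | a :: l, b => by
    obtain ⟨h1, h2, h3⟩ := foldl_min_spec l (min b a)
    refine ⟨h1.trans (min_le_left _ _), fun x hx => ?_, ?_⟩
    · rcases List.mem_cons.1 hx with rfl | hx
      · exact h1.trans (min_le_right _ _)
      · exact h2 x hx
    · rw [List.foldl_cons]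
      rcases h3 with h3 | h3
      · rw [h3]
        rcases le_total b a with hba | hab
        · left; exact min_eq_left hba
        · right; rw [min_eq_right hab]; exact List.mem_cons_self
      · exact Or.inr (List.mem_cons_of_mem a h3)

/-- **The `X`-content exponent** on lists: the least valuation of a nonzero row. [cite: RothRuckenstein2000, §V, Lemma 5.1] -/
def xvalL (Ql : List (List ℕ)) : ℕ := ((Ql.filter fun r => !kpIsZero r).map kpVal).foldl min (bMaxLen Ql)

/-- Coefficients of `Q(0, Y)` after `k` divisions by `X`. [folklore] -/
theorem coeff_atZero_iterate_cdivX {K : Type*} [Field K] (k : ℕ) (Q : K[X][Y]) (j : ℕ) :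
    (atZero (cdivX^[k] Q)).coeff j = (Q.coeff j).coeff k := by
  rw [coeff_atZero, coeff_iterate_cdivX, coeff_iterate_divX, zero_add]

/-- A characterisation of `xval`: the least `k` at which some `Y`-coefficient has a nonzero
`Xᵏ`-coefficient. [folklore] -/
theorem xval_eq_of_least {K : Type*} [Field K] {Q : K[X][Y]} (hQ : Q ≠ 0) {k : ℕ}
    (h1 : atZero (cdivX^[k] Q) ≠ 0) (h2 : ∀ k', k' < k → atZero (cdivX^[k'] Q) = 0) : xval Q = k := by
  refine le_antisymm (xval_le_of_ne hQ h1) (not_lt.1 fun hlt => ?_)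
  exact atZero_stripX_ne_zero hQ (by rw [stripX]; exact h2 _ hlt)

/-- **`xvalL` computes the `X`-content exponent** of a nonzero reduced matrix. [cite: RothRuckenstein2000, §V, Lemma 5.1] -/
theorem xvalL_eq_xval {Ql : List (List ℕ)} (h : KRedRows M Ql) (hQ : bivOf M Ql ≠ 0) : xvalL Ql = xval (bivOf M Ql) := by
  set nz := Ql.filter fun r => !kpIsZero r with hnz
  obtain ⟨hle0, hle, hmem⟩ := foldl_min_spec (nz.map kpVal) (bMaxLen Ql)
  have hnzmem : ∀ r, r ∈ nz ↔ r ∈ Ql ∧ polyOfList M r ≠ 0 := fun r => by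
    rw [hnz, List.mem_filter]
    refine and_congr_right fun hr => ?_
    rw [Bool.not_eq_true', ← Bool.not_eq_true, kpIsZero_iff (h r hr)]
  -- some row is nonzero
  obtain ⟨r₀, hr₀, hr₀ne⟩ : ∃ r ∈ Ql, polyOfList M r ≠ 0 := by
    by_contra hall
    push Not at hall
    exact hQ (bivOf_eq_zero_iff.2 hall)
  -- the minimum is attained at a nonzero row
  obtain ⟨r₁, hr₁, hr₁v⟩ : ∃ r ∈ nz, xvalL Ql = kpVal r := by
    rcases hmem with hm | hm
    · -- the default equals the minimum: then `kpVal r₀ = bMaxLen` too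
      have h0 : r₀ ∈ nz := (hnzmem r₀).2 ⟨hr₀, hr₀ne⟩
      have hv := hle (kpVal r₀) (List.mem_map.2 ⟨r₀, h0, rfl⟩)
      refine ⟨r₀, h0, le_antisymm hv ?_⟩
      rw [xvalL, ← hnz, hm]
      exact ((kpVal_spec r₀).2.2.trans (length_le_bMaxLen hr₀))
    · obtain ⟨r, hr, hrv⟩ := List.mem_map.1 hm
      exact ⟨r, hr, by rw [xvalL, ← hnz, ← hrv]⟩
  obtain ⟨hr₁Q, hr₁ne⟩ := (hnzmem r₁).1 hr₁
  obtain ⟨j₁, hj₁, rfl⟩ := List.getElem_of_mem hr₁Q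
  symm
  apply xval_eq_of_least hQ
  · -- the coefficient `j₁` of `atZero (cdivX^[k] Q)` is nonzero
    intro h0
    have hc := congrArg (fun q : (GF2 M)[X] => q.coeff j₁) h0
    simp only [coeff_atZero_iterate_cdivX, coeff_bivOf, if_pos hj₁, coeff_zero, List.getD_eq_getElem _ _ hj₁] at hc
    rw [hr₁v] at hc
    exact ((kpVal_coeff (h _ (List.getElem_mem hj₁))).2 hr₁ne).2 hc
  · intro k' hk'
    ext j
    rw [coeff_atZero_iterate_cdivX, coeff_bivOf, coeff_zero]
    split_ifs with hj
    · set r := Ql.getD j [] with hr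
      have hrQ : r ∈ Ql := by rw [hr, List.getD_eq_getElem _ _ hj]; exact List.getElem_mem hj
      by_cases hz : polyOfList M r = 0
      · rw [hz, coeff_zero]
      · have hrnz : r ∈ nz := (hnzmem r).2 ⟨hrQ, hz⟩
        have hkv : xvalL Ql ≤ kpVal r := by rw [xvalL, ← hnz]; exact hle _ (List.mem_map.2 ⟨r, hrnz, rfl⟩)
        exact (kpVal_coeff (h r hrQ)).1 k' (by omega)
    · rw [coeff_zero]

/-- **`Q` stripped of its `X`-content power** on lists: drop `xvalL` coefficients from every row.
[cite: RothRuckenstein2000, §V, Lemma 5.1] -/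
def stripXL (Ql : List (List ℕ)) : List (List ℕ) := Ql.map (List.drop (xvalL Ql))

variable (M)

/-- Dropping `k` coefficients from every row divides by `Xᵏ`. [folklore] -/
theorem bivOf_map_drop (k : ℕ) (Ql : List (List ℕ)) : bivOf M (Ql.map (List.drop k)) = cdivX^[k] (bivOf M Ql) := by
  ext j : 1
  rw [coeff_iterate_cdivX, coeff_bivOf, coeff_bivOf, List.length_map]
  split_ifs with hj
  · rw [show (Ql.map (List.drop k)).getD j [] = (Ql.map (List.drop k)).getD j (List.drop k []) by rw [List.drop_nil],
      List.getD_map, polyOfList_drop]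
  · clear hj
    induction k with
    | zero => rfl
    | succ k ih => rw [Function.iterate_succ_apply', ← ih, divX_zero]

variable {M}

/-- **`stripXL` computes `stripX`** on reduced data. [cite: RothRuckenstein2000, §V, Lemma 5.1] -/
theorem bivOf_stripXL {Ql : List (List ℕ)} (h : KRedRows M Ql) : bivOf M (stripXL Ql) = stripX (bivOf M Ql) := by
  by_cases hQ : bivOf M Ql = 0
  · rw [hQ, stripX_zero, stripXL, bivOf_map_drop, hQ]
    clear h hQ
    induction xvalL Ql with
    | zero => rfl
    | succ k ih => rw [Function.iterate_succ_apply', ih, cdivX_zero]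
  · rw [stripXL, bivOf_map_drop, xvalL_eq_xval h hQ, stripX]

/-- `stripXL` keeps reducedness and the number of rows. [folklore] -/
theorem KRedRows.stripXL {Ql : List (List ℕ)} (h : KRedRows M Ql) : KRedRows M (stripXL Ql) := by
  intro r hr
  obtain ⟨r', hr', rfl⟩ := List.mem_map.1 hr
  exact (h r' hr').drop _

/-! ### The substitution `Y ↦ XY + γ` by Horner's rule -/

/-- Multiplication by `S = X·Y + γ`: `Σ R_j Yʲ ↦ Σ (X R_{j-1} + γ R_j) Yʲ`. [cite: KnuthTAOCP2, §4.6.1] -/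
def mulS (c : ℕ × ℕ × ℕ) (γ : ℕ) (R : List (List ℕ)) : List (List ℕ) :=
  List.zipWith (kpadd c.1) ([] :: R.map (List.cons 0)) (R.map (lsmul c γ) ++ [[]])

/-- Adding a polynomial to the `Y⁰`-coefficient. [cite: KnuthTAOCP2, §4.6.1] -/
def addHead (c : ℕ × ℕ × ℕ) (R : List (List ℕ)) (P : List ℕ) : List (List ℕ) :=
  List.zipWith (kpadd c.1) R (P :: List.replicate R.length [])

/-- **`Q(X, XY + γ)` by Horner's rule in `Y`.** [cite: RothRuckenstein2000, §V, Lemma 5.1; KnuthTAOCP2, §4.6.4] -/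
def shiftYL (c : ℕ × ℕ × ℕ) (γ : ℕ) (Ql : List (List ℕ)) : List (List ℕ) :=
  Ql.reverse.foldl (fun R P => addHead c (mulS c γ R) P) []

/-- `polyOfList (0 :: r) = X · polyOfList r`. [folklore] -/
theorem polyOfList_cons_zero (M : ℕ) (r : List ℕ) : polyOfList M (0 :: r) = X * polyOfList M r := by
  rw [polyOfList_cons, GF2.elt, bitsPoly_zero, map_zero, map_zero, zero_add]

/-- Length of `mulS`. [folklore] -/
theorem length_mulS (c : ℕ × ℕ × ℕ) (γ : ℕ) (R : List (List ℕ)) : (mulS c γ R).length = R.length + 1 := by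
  rw [mulS, List.length_zipWith, List.length_cons, List.length_map, List.length_append, List.length_map,
    List.length_singleton, min_self]

/-- **`mulS` multiplies by `X·Y + γ`** on reduced data, and keeps reducedness. [cite: KnuthTAOCP2, §4.6.1] -/
theorem bivOf_mulS {γ : ℕ} (hγ : γ < 2 ^ (M + 1)) {R : List (List ℕ)} (h : KRedRows M R) :
    bivOf M (mulS (kctx M) γ R) = bivOf M R * (C X * Y + CC (GF2.elt M γ)) ∧ KRedRows M (mulS (kctx M) γ R) := by
  have hlen := length_mulS (kctx M) γ R
  -- the two operand rows at index `j`
  have hA : ∀ j, KRed M (([] :: R.map (List.cons 0)).getD j []) ∧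
      polyOfList M (([] :: R.map (List.cons 0)).getD j []) = if j = 0 then 0 else X * polyOfList M (R.getD (j - 1) []) := by
    intro j
    cases j with
    | zero => exact ⟨by rw [List.getD_cons_zero]; exact KRed.nil, by rw [List.getD_cons_zero, polyOfList_nil, if_pos rfl]⟩
    | succ j =>
      rw [List.getD_cons_succ, if_neg (Nat.succ_ne_zero j), Nat.succ_sub_one]
      by_cases hj : j < R.length
      · rw [List.getD_eq_getElem _ _ (by rw [List.length_map]; exact hj), List.getElem_map, List.getD_eq_getElem _ _ hj]
        exact ⟨(h _ (List.getElem_mem hj)).cons (Nat.two_pow_pos _), polyOfList_cons_zero M _⟩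
      · rw [List.getD_eq_default _ _ (by rw [List.length_map]; omega), List.getD_eq_default _ _ (not_lt.1 hj),
          polyOfList_nil, mul_zero]
        exact ⟨KRed.nil, rfl⟩
  have hB : ∀ j, KRed M ((R.map (lsmul (kctx M) γ) ++ [[]]).getD j []) ∧
      polyOfList M ((R.map (lsmul (kctx M) γ) ++ [[]]).getD j []) = C (GF2.elt M γ) * polyOfList M (R.getD j []) := by
    intro j
    by_cases hj : j < R.length
    · rw [List.getD_append _ _ _ _ (by rw [List.length_map]; exact hj),
        List.getD_eq_getElem _ _ (by rw [List.length_map]; exact hj), List.getElem_map, List.getD_eq_getElem _ _ hj]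
      obtain ⟨h1, h2⟩ := lsmul_spec' hγ (h _ (List.getElem_mem hj))
      exact ⟨h2, h1⟩
    · rw [List.getD_append_right _ _ _ _ (by rw [List.length_map]; omega), List.length_map,
        List.getD_eq_default _ _ (not_lt.1 hj), polyOfList_nil, mul_zero]
      refine ⟨?_, ?_⟩
      · rcases Nat.lt_or_ge (j - R.length) 1 with h1 | h1
        · rw [List.getD_eq_getElem _ _ (by simpa using h1)]; simp [KRed]
        · rw [List.getD_eq_default _ _ (by simpa using h1)]; exact KRed.nil
      · rcases Nat.lt_or_ge (j - R.length) 1 with h1 | h1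
        · rw [List.getD_eq_getElem _ _ (by simpa using h1)]; simp
        · rw [List.getD_eq_default _ _ (by simpa using h1), polyOfList_nil]
  have hent : ∀ j, j < R.length + 1 → (mulS (kctx M) γ R).getD j [] =
      kpadd (M + 2) (([] :: R.map (List.cons 0)).getD j []) ((R.map (lsmul (kctx M) γ) ++ [[]]).getD j []) := by
    intro j hj
    rw [mulS, List.getD_eq_getElem _ _ (by rw [← mulS, hlen]; exact hj), List.getElem_zipWith,
      List.getD_eq_getElem _ _ (by rw [List.length_cons, List.length_map]; exact hj),
      List.getD_eq_getElem _ _ (by rw [List.length_append, List.length_map, List.length_singleton]; exact hj)]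
    rfl
  refine ⟨?_, fun r hr => ?_⟩
  · ext j : 1
    rw [coeff_bivOf, hlen, mul_add, coeff_add]
    have e1 : (bivOf M R * (C X * Y)).coeff j = if j = 0 then 0 else (bivOf M R).coeff (j - 1) * X := by
      rw [← mul_assoc]
      cases j with
      | zero => rw [coeff_mul_X_zero, if_pos rfl]
      | succ j => rw [coeff_mul_X, coeff_mul_C, if_neg (Nat.succ_ne_zero j), Nat.succ_sub_one]
    have e2 : (bivOf M R * CC (GF2.elt M γ)).coeff j = (bivOf M R).coeff j * C (GF2.elt M γ) := by
      rw [CC, coeff_mul_C]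
    rw [e1, e2, coeff_bivOf, coeff_bivOf]
    by_cases hj : j < R.length + 1
    · rw [if_pos hj, hent j hj, (kpadd_spec (hA j).1 (hB j).1).1, (hA j).2, (hB j).2]
      congr 1
      · split_ifs with h0 h1
        · rfl
        · rw [mul_comm]
        · exfalso; omega
      · split_ifs with h1
        · rw [mul_comm]
        · rw [List.getD_eq_default _ _ (not_lt.1 h1), polyOfList_nil, mul_zero, zero_mul]
    · rw [if_neg hj, if_neg (by omega), if_neg (by omega), if_neg (by omega), zero_mul, zero_mul, add_zero]
  · obtain ⟨j, hj, rfl⟩ := List.getElem_of_mem hr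
    rw [hlen] at hj
    rw [← List.getD_eq_getElem _ [] (by rw [hlen]; exact hj), hent j hj]
    exact (kpadd_spec (hA j).1 (hB j).1).2

/-- **`addHead` adds to the `Y⁰`-coefficient** (nonempty `R`), and keeps reducedness. [folklore] -/
theorem bivOf_addHead {R : List (List ℕ)} (hR : KRedRows M R) (hR0 : R ≠ []) {P : List ℕ} (hP : KRed M P) :
    bivOf M (addHead (kctx M) R P) = bivOf M R + C (polyOfList M P) ∧ KRedRows M (addHead (kctx M) R P) := by
  have hlen : (addHead (kctx M) R P).length = R.length := by
    rw [addHead, List.length_zipWith, List.length_cons, List.length_replicate]; omega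
  have hD : ∀ j, KRed M ((P :: List.replicate R.length []).getD j []) ∧
      polyOfList M ((P :: List.replicate R.length []).getD j []) = if j = 0 then polyOfList M P else 0 := by
    intro j
    cases j with
    | zero => rw [List.getD_cons_zero, if_pos rfl]; exact ⟨hP, rfl⟩
    | succ j =>
      rw [List.getD_cons_succ, if_neg (Nat.succ_ne_zero j), List.getD_eq_getElem?_getD,
        List.getElem?_getD_replicate_default_eq]
      exact ⟨KRed.nil, polyOfList_nil M⟩
  have hent : ∀ j, j < R.length → (addHead (kctx M) R P).getD j [] = kpadd (M + 2) (R.getD j []) ((P :: List.replicate R.length []).getD j []) := by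
    intro j hj
    rw [addHead, List.getD_eq_getElem _ _ (by rw [← addHead, hlen]; exact hj), List.getElem_zipWith,
      List.getD_eq_getElem _ _ hj, List.getD_eq_getElem _ _ (by rw [List.length_cons, List.length_replicate]; omega)]
    rfl
  refine ⟨?_, fun r hr => ?_⟩
  · ext j : 1
    rw [coeff_add, coeff_bivOf, coeff_bivOf, coeff_C, hlen]
    by_cases hj : j < R.length
    · rw [if_pos hj, if_pos hj, hent j hj, (kpadd_spec (hR.getD j) (hD j).1).1, (hD j).2]
    · have : j ≠ 0 := fun h0 => hj (by rw [h0]; exact List.length_pos_of_ne_nil hR0)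
      rw [if_neg hj, if_neg hj, if_neg this, add_zero]
  · obtain ⟨j, hj, rfl⟩ := List.getElem_of_mem hr
    rw [hlen] at hj
    rw [← List.getD_eq_getElem _ [] (by rw [hlen]; exact hj), hent j hj]
    exact (kpadd_spec (hR.getD j) (hD j).1).2

/-- Unfolding `shiftYL` on `cons`. [folklore] -/
theorem shiftYL_cons (c : ℕ × ℕ × ℕ) (γ : ℕ) (P : List ℕ) (Ql : List (List ℕ)) :
    shiftYL c γ (P :: Ql) = addHead c (mulS c γ (shiftYL c γ Ql)) P := by
  rw [shiftYL, shiftYL, List.reverse_cons, List.foldl_append, List.foldl_cons, List.foldl_nil]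

/-- `shiftYL` keeps the number of rows. [folklore] -/
theorem length_shiftYL (c : ℕ × ℕ × ℕ) (γ : ℕ) : ∀ Ql : List (List ℕ), (shiftYL c γ Ql).length = Ql.length
  | [] => rfl
  | P :: Ql => by
    rw [shiftYL_cons, addHead, List.length_zipWith, length_mulS, length_shiftYL c γ Ql, List.length_cons,
      List.length_replicate, List.length_cons]
    omega

/-- **`shiftYL` computes `Q(X, XY + γ)`** on reduced data, and keeps reducedness.
[cite: RothRuckenstein2000, §V, Lemma 5.1] -/
theorem bivOf_shiftYL {γ : ℕ} (hγ : γ < 2 ^ (M + 1)) : ∀ {Ql : List (List ℕ)}, KRedRows M Ql →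
    bivOf M (shiftYL (kctx M) γ Ql) = shiftY (bivOf M Ql) (GF2.elt M γ) ∧ KRedRows M (shiftYL (kctx M) γ Ql)
  | [], _ => by simp [shiftYL, shiftY, KRedRows]
  | P :: Ql, h => by
    obtain ⟨ih1, ih2⟩ := bivOf_shiftYL hγ (fun r hr => h r (List.mem_cons_of_mem P hr))
    obtain ⟨hm1, hm2⟩ := bivOf_mulS hγ ih2
    have hne : mulS (kctx M) γ (shiftYL (kctx M) γ Ql) ≠ [] := by
      rw [← List.length_pos_iff_ne_nil, length_mulS]; omega
    obtain ⟨ha1, ha2⟩ := bivOf_addHead hm2 hne (h P List.mem_cons_self)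
    rw [shiftYL_cons]
    refine ⟨?_, ha2⟩
    rw [ha1, hm1, ih1, bivOf_cons, shiftY, shiftY, add_comp, C_comp, mul_comp, X_comp]
    ring

/-- **The child** `Q₀(X, XY + γ)` on lists. [cite: RothRuckenstein2000, §V, Fig. 2] -/
def childQL (c : ℕ × ℕ × ℕ) (γ : ℕ) (Ql : List (List ℕ)) : List (List ℕ) := shiftYL c γ (stripXL Ql)

/-- **`childQL` computes `childQ`** on reduced data, and keeps reducedness. [folklore] -/
theorem bivOf_childQL {γ : ℕ} (hγ : γ < 2 ^ (M + 1)) {Ql : List (List ℕ)} (h : KRedRows M Ql) :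
    bivOf M (childQL (kctx M) γ Ql) = childQ (bivOf M Ql) (GF2.elt M γ) ∧ KRedRows M (childQL (kctx M) γ Ql) := by
  obtain ⟨h1, h2⟩ := bivOf_shiftYL hγ h.stripXL
  exact ⟨by rw [childQL, h1, bivOf_stripXL h, childQ], h2⟩

/-! ### The root search and the expansion of a node -/

/-- **The roots of `Q₀(0, Y)` among `elems`** on lists. [cite: RothRuckenstein2000, §V, Fig. 2] -/
def rootsLK (c : ℕ × ℕ × ℕ) (elems : List ℕ) (Ql : List (List ℕ)) : List ℕ :=
  elems.filter fun γ => keval c (atZeroL (stripXL Ql)) γ == 0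

/-- **`rootsLK` computes `rootsL`** on reduced data with a reduced enumeration. [folklore] -/
theorem map_rootsLK {elems : List ℕ} (hel : ∀ γ ∈ elems, γ < 2 ^ (M + 1)) {Ql : List (List ℕ)} (h : KRedRows M Ql) :
    (rootsLK (kctx M) elems Ql).map (GF2.elt M) = rootsL (elems.map (GF2.elt M)) (bivOf M Ql) := by
  rw [rootsL, rootsLK, List.filter_map]
  congr 1
  refine List.filter_congr fun γ hγ => ?_
  obtain ⟨hv, hlt⟩ := keval_spec (hel γ hγ) h.stripXL.atZeroL
  rw [Function.comp_apply, ← bivOf_stripXL h, ← polyOfList_atZeroL, ← hv]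
  rw [Bool.eq_iff_iff, beq_iff_eq, decide_eq_true_eq]
  exact ⟨fun h0 => by rw [h0, GF2.elt, bitsPoly_zero, map_zero], fun h0 => by_contra fun hne => GF2.elt_ne_zero hne hlt h0⟩

/-- **The children of a node** on lists. [cite: RothRuckenstein2000, §V, Fig. 2] -/
def rrExpandL (c : ℕ × ℕ × ℕ) (elems : List ℕ) (nd : List ℕ × List (List ℕ)) : List (List ℕ × List (List ℕ)) :=
  if bIsZero nd.2 then [] else (rootsLK c elems nd.2).map fun γ => (nd.1 ++ [γ], childQL c γ nd.2)

/-- Interpretation of a node. [folklore] -/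
def castNode (M : ℕ) (nd : List ℕ × List (List ℕ)) : List (GF2 M) × (GF2 M)[X][Y] := (nd.1.map (GF2.elt M), bivOf M nd.2)

/-- Reduced nodes. [folklore] -/
def NRed (M : ℕ) (nd : List ℕ × List (List ℕ)) : Prop := KRed M nd.1 ∧ KRedRows M nd.2

/-- **`rrExpandL` computes `rrExpand`** on reduced nodes, and outputs reduced nodes.
[cite: RothRuckenstein2000, §V, Fig. 2] -/
theorem map_rrExpandL {elems : List ℕ} (hel : ∀ γ ∈ elems, γ < 2 ^ (M + 1)) {nd : List ℕ × List (List ℕ)} (h : NRed M nd) :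
    (rrExpandL (kctx M) elems nd).map (castNode M) = rrExpand (elems.map (GF2.elt M)) (castNode M nd) ∧
      ∀ nd' ∈ rrExpandL (kctx M) elems nd, NRed M nd' := by
  obtain ⟨p, Ql⟩ := nd
  obtain ⟨hp, hQ⟩ := h
  by_cases hz : bivOf M Ql = 0
  · have hb : bIsZero Ql = true := (bIsZero_iff hQ).2 hz
    simp only [rrExpandL, hb, castNode, rrExpand, hz]
    simp
  · have hb : bIsZero Ql = false := by
      rw [← Bool.not_eq_true, bIsZero_iff hQ]; exact hz
    have hcn : castNode M (p, Ql) = (p.map (GF2.elt M), bivOf M Ql) := rfl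
    refine ⟨?_, fun nd' hnd' => ?_⟩
    · rw [hcn, rrExpand, if_neg (show ¬ (p.map (GF2.elt M), bivOf M Ql).2 = 0 from hz), rrExpandL]
      simp only [hb, Bool.false_eq_true, ↓reduceIte]
      rw [← map_rootsLK hel hQ, List.map_map, List.map_map]
      refine List.map_congr_left fun γ hγ => ?_
      have hγ' : γ < 2 ^ (M + 1) := hel γ (List.mem_filter.1 hγ).1
      simp only [Function.comp_apply, castNode, List.map_append, List.map_cons, List.map_nil]
      rw [(bivOf_childQL hγ' hQ).1]
    · rw [rrExpandL] at hnd'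
      simp only [hb, Bool.false_eq_true, ↓reduceIte] at hnd'
      obtain ⟨γ, hγ, rfl⟩ := List.mem_map.1 hnd'
      have hγ' : γ < 2 ^ (M + 1) := hel γ (List.mem_filter.1 hγ).1
      refine ⟨fun x hx => ?_, (bivOf_childQL hγ' hQ).2⟩
      rw [List.mem_append, List.mem_singleton] at hx
      rcases hx with hx | rfl
      · exact hp x hx
      · exact hγ'

/-! ### The levels -/

/-- **Roth–Ruckenstein's recursion, breadth first with a frontier cap**, on lists.
[cite: RothRuckenstein2000, §V, Fig. 2] -/
def rrLevelsL (c : ℕ × ℕ × ℕ) (elems : List ℕ) (cap t : ℕ) (Ql : List (List ℕ)) : List (List ℕ × List (List ℕ)) :=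
  (List.replicate t ()).foldl (fun F _ => (F.flatMap (rrExpandL c elems)).take cap) [([], Ql)]

/-- One more level. [folklore] -/
theorem rrLevelsL_succ (c : ℕ × ℕ × ℕ) (elems : List ℕ) (cap t : ℕ) (Ql : List (List ℕ)) :
    rrLevelsL c elems cap (t + 1) Ql = ((rrLevelsL c elems cap t Ql).flatMap (rrExpandL c elems)).take cap := by
  rw [rrLevelsL, rrLevelsL, List.replicate_succ', List.foldl_append, List.foldl_cons, List.foldl_nil]

/-- **`rrLevelsL` computes `rrLevels`** on reduced data, and lists reduced nodes.
[cite: RothRuckenstein2000, §V, Fig. 2] -/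
theorem map_rrLevelsL {elems : List ℕ} (hel : ∀ γ ∈ elems, γ < 2 ^ (M + 1)) (cap : ℕ) {Ql : List (List ℕ)} (hQ : KRedRows M Ql) :
    ∀ t : ℕ, (rrLevelsL (kctx M) elems cap t Ql).map (castNode M) = rrLevels (elems.map (GF2.elt M)) cap t (bivOf M Ql) ∧
      ∀ nd ∈ rrLevelsL (kctx M) elems cap t Ql, NRed M nd
  | 0 => ⟨rfl, fun nd hnd => by
      simp only [rrLevelsL, List.replicate_zero, List.foldl_nil, List.mem_singleton] at hnd
      subst hnd; exact ⟨KRed.nil, hQ⟩⟩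
  | t + 1 => by
    obtain ⟨ih1, ih2⟩ := map_rrLevelsL hel cap hQ t
    rw [rrLevelsL_succ, rrLevels_succ, ← ih1, List.map_take, List.map_flatMap, List.flatMap_map]
    refine ⟨?_, fun nd hnd => ?_⟩
    · congr 1
      exact List.flatMap_congr fun nd hnd => (map_rrExpandL hel (ih2 nd hnd)).1
    · obtain ⟨nd₀, hnd₀, hmem⟩ := List.mem_flatMap.1 (List.mem_of_mem_take hnd)
      exact (map_rrExpandL hel (ih2 nd₀ hnd₀)).2 nd hmem

/-- `ofCoeffs` of an interpreted path is `polyOfList` of the path. [folklore] -/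
theorem ofCoeffs_map_elt (M : ℕ) (p : List ℕ) : ofCoeffs (p.map (GF2.elt M)) = polyOfList M p := by
  rw [ofCoeffs, polyOfList, List.length_map]
  refine Finset.sum_congr rfl fun i _ => ?_
  rw [show (0 : GF2 M) = GF2.elt M 0 by rw [GF2.elt, bitsPoly_zero, map_zero], List.getD_map]

/-- **Completeness of the root finder on lists.** For reduced `Ql` with `Q = bivOf Ql ≠ 0`,
`max 1 (deg_Y Q) ≤ cap`, and the full enumeration `elems = [0, 2^{M+1})`: every `Y`-root `f` of
`Q` with `deg f ≤ D` is `polyOfList p` for some listed path `p` of level `D + 1`.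
[cite: RothRuckenstein2000, §V, Prop. 5.2; §VI, Prop. 6.4] -/
theorem rrLevelsL_complete {Ql : List (List ℕ)} (hQ : KRedRows M Ql) (hQ0 : bivOf M Ql ≠ 0) {cap D : ℕ}
    (hcap : max 1 (bivOf M Ql).natDegree ≤ cap) {f : (GF2 M)[X]} (hf : f.natDegree ≤ D) (hev : (bivOf M Ql).eval f = 0) :
    ∃ nd ∈ rrLevelsL (kctx M) (kelems M) cap (D + 1) Ql, polyOfList M nd.1 = f := by
  have hel : ∀ γ ∈ kelems M, γ < 2 ^ (M + 1) := fun _ hγ => List.mem_range.1 hγ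
  have hnd : ((kelems M).map (GF2.elt M)).Nodup :=
    (List.nodup_map_iff_inj_on (nodup_kelems M)).2 fun a ha b hb hab => GF2.elt_injective (hel a ha) (hel b hb) hab
  obtain ⟨nd, hmem, hf⟩ := rrLevels_complete hnd (kelems_map_elt_perm M) hQ0 hcap hf hev
  rw [← (map_rrLevelsL hel cap hQ (D + 1)).1, List.mem_map] at hmem
  obtain ⟨nd', hnd', rfl⟩ := hmem
  exact ⟨nd', hnd', by rw [← hf, castNode, ofCoeffs_map_elt]⟩

/-- Listed paths are reduced. [folklore] -/
theorem rrLevelsL_reduced {Ql : List (List ℕ)} (hQ : KRedRows M Ql) (cap t : ℕ) :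
    ∀ nd ∈ rrLevelsL (kctx M) (kelems M) cap t Ql, KRed M nd.1 :=
  fun nd hnd => ((map_rrLevelsL (fun _ hγ => List.mem_range.1 hγ) cap hQ t).2 nd hnd).1

end UmansFP

end Literature.Computability.Complexity

end
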